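import Literature.Probability.Process.MartingaleProblemTilting
import Literature.Probability.RandomPlanarGeometry.AngleTiltFunction
import Literature.Probability.RandomPlanarGeometry.StationaryAngleFiltration
import HarnessLib

/-!
# Changing the force-point drift of the SLE_κ(ρ) angle diffusion by an exponential change of measure

Topic `Probability/RandomPlanarGeometry`; theorems only, sequel of `MartingaleProblemTilting`
(`Probability/Process`), `AngleTiltFunction`, `StationaryAngleFiltration`. Let `X` be a continuous,
progressively measurable real process on a filtered probability space `(Ω, 𝓕, P)` solving the
SLE_κ(ρ₁) angle **martingale problem in martingale form**: for every `C²` test function `f`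
supported in `[ε/2, 2π - ε/2]`,

  `N^f_t = f(X_t) - f(X_0) - ∫₀ᵗ (L_{ρ₁} f)(X_s) ds`

is an `𝓕`-martingale (`L_ρ = angleGenerator κ ρ = (κ/2) ∂² + ((ρ+2)/2) cot(·/2) ∂`;
Miller–Sheffield (2013), §2.1.2, eq. (2.5); Karatzas–Shreve (1988), Ch. 5 §4.B). Then for every
target parameter `ρ₂` and horizon `T`, the exponential density `N_T` of the localised tilt function
`g ≈ sin(·/2)^{(ρ₂-ρ₁)/κ}` (`exists_angleTilt_target`, the `h`-transform relating `L_{ρ₁}` and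
`L_{ρ₂}`; `martingale_expDensity`) defines a probability measure `Q = N_T · P`, mutually absolutely
continuous with `P`, under which **the `(κ, ρ₂)` martingale problem holds on `[0, T]` for all test
functions supported in `(ε, 2π - ε)`** (`exists_tilted_measure_target`). Two instances:

* `ρ₁ = ρ`, `ρ₂ = 0` on the two-sided path space `C(ℝ, ℝ)` with the past filtration and the
  coordinate process (`exists_tilted_measure`): the force-point drift `(ρ/2) cot(X/2)` of the
  driving function of whole-plane / radial SLE_κ(ρ) (Miller–Sheffield (2013), (2.5)) is removed
  while `X` stays `ε`-away from `{0, 2π}` — the absolute-continuity statement "its evolution is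
  absolutely continuous with respect to …" of Miller–Sheffield (2013), discussion after (2.5),
  obtained there by the Girsanov theorem, here by the exponential change of measure of
  Palmowski–Rolski (2002), Thm 4.2, without stochastic integration; every stationary angle law
  `IsStationaryAngleLaw κ ρ P` solves the martingale problem in this form
  (`IsStationaryAngleLaw.martingale_angleIncrement`);
* `ρ₁ = 0`, `ρ₂ = κ - 6` (for the radial Bessel flow of radial SLE_κ seen from a marked boundary
  point): the passage from radial SLE_κ to radial SLE_κ(κ - 6), i.e. to chordal SLE_κ aimed at the
  marked point (Schramm–Wilson (2005), coordinate changes), in the same weak form.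

The hypothesis only asks for test functions supported in the closed interval `[ε/2, 2π - ε/2]`, so
that a process *stopped* on leaving a larger open interval (where all these test functions and
their generators vanish at the frozen value) qualifies.

Everything is proved; no definition and no named fact is introduced.

## References

* J. Miller, S. Sheffield, *Imaginary geometry IV*, PTRF 169 (2017), arXiv:1302.4738, §2.1.2,
  eq. (2.5) and the discussion after it; Prop. 2.3 (proof). [MillerSheffield2013]
* I. Karatzas, S. Shreve, *Brownian Motion and Stochastic Calculus* (1988), Ch. 5 §4.B.
  [KaratzasShreve1988]
* Z. Palmowski, T. Rolski, Bernoulli 8 (2002), Thm 4.2. [PalmowskiRolski2002]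
* O. Schramm, D. B. Wilson, *SLE coordinate changes*, New York J. Math. 11 (2005), 659–669.
-/

noncomputable section

open MeasureTheory ProbabilityTheory Filter Set Function Metric
open scoped NNReal ENNReal Topology

namespace Literature.Probability.RandomPlanarGeometry

open scoped PathBorel
open Literature.Probability.Process Literature.Analysis.FunctionSpaces Real

/-! ### The tilt function between two force-point parameters -/

section TiltTarget

/-- **The localised tilt function from SLE_κ(ρ₁) to SLE_κ(ρ₂).** For `κ > 0`, `ρ₁, ρ₂ ∈ ℝ` and
`0 < ε < π` there are continuous `g, V : ℝ → ℝ` and constants `0 < c`, `C_g`, `C_V` with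
`c ≤ g ≤ C_g`, `|V| ≤ C_V`, such that `g - 1` is `C²` with `tsupport (g - 1) ⊆ [ε/2, 2π - ε/2]`,
`angleGenerator κ ρ₁ (g - 1) = V g` (`V = L_{ρ₁} g / g`), and for every `C²` test function `F`
supported in `(ε, 2π - ε)` the product `g F` is `C²` with `tsupport (gF) ⊆ tsupport F` and the
**`h`-transform identity** `angleGenerator κ ρ₁ (gF) - V g F = g · angleGenerator κ ρ₂ F` holds on
`ℝ` (on `(ε, 2π - ε)` one has `g = sin(·/2)^{(ρ₂-ρ₁)/κ}` locally, so
`κ g'/g = ((ρ₂ - ρ₁)/2) cot(·/2)`, which is `L_{ρ₂} - L_{ρ₁}` on first-order terms; generic identity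
`L(gF) - (Lg/g) gF = g (LF + κ (g'/g) F')`). [cite: MillerSheffield2013, §2.1.2] -/
theorem exists_angleTilt_target (κ : ℝ≥0) (ρ₁ ρ₂ : ℝ) (hκ : 0 < κ) {ε : ℝ} (hε : 0 < ε) (hεπ : ε < π) :
    ∃ g V : ℝ → ℝ, ∃ c Cg CV : ℝ, 0 < c ∧ Continuous g ∧ Continuous V ∧ (∀ x, c ≤ g x) ∧
      (∀ x, |g x| ≤ Cg) ∧ (∀ x, |V x| ≤ CV) ∧
      ContDiff ℝ 2 (fun x ↦ g x - 1) ∧ tsupport (fun x ↦ g x - 1) ⊆ Icc (ε / 2) (2 * π - ε / 2) ∧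
      (∀ x, angleGenerator κ ρ₁ (fun x ↦ g x - 1) x = V x * g x) ∧
      ∀ F : ℝ → ℝ, ContDiff ℝ 2 F → tsupport F ⊆ Ioo ε (2 * π - ε) →
        ContDiff ℝ 2 (fun x ↦ g x * F x) ∧ tsupport (fun x ↦ g x * F x) ⊆ tsupport F ∧
          ∀ x, angleGenerator κ ρ₁ (fun x ↦ g x * F x) x - V x * (g x * F x) =
            g x * angleGenerator κ ρ₂ F x := by
  -- the bump `χ = 1` on `[ε, 2π - ε]`, supported in `[ε/2, 2π - ε/2]`, exponent `p = (ρ₂ - ρ₁)/κ`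
  let χ : ContDiffBump (π : ℝ) := ⟨π - ε, π - ε / 2, by linarith, by linarith⟩
  have hχ : χ.rOut < π := by change π - ε / 2 < π; linarith
  have hrIn : χ.rIn = π - ε := rfl
  have hrOut : χ.rOut = π - ε / 2 := rfl
  set p : ℝ := (ρ₂ - ρ₁) / κ with hp
  have hκp : (κ : ℝ) * (p / 2) = (ρ₂ - ρ₁) / 2 := by
    have hκ0 : (κ : ℝ) ≠ 0 := by exact_mod_cast hκ.ne'
    rw [hp]; field_simp
  set g : ℝ → ℝ := fun x ↦ 1 + χ x * (Real.sin (x / 2) ^ p - 1) with hgdef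
  set g₁ : ℝ → ℝ := fun x ↦ χ x * (Real.sin (x / 2) ^ p - 1) with hg₁def
  have hg₁g : (fun x ↦ g x - 1) = g₁ := by funext x; simp [hgdef, hg₁def]
  have hgC : ContDiff ℝ 2 g := contDiff_tilt hχ
  have hg₁C : ContDiff ℝ 2 g₁ := by rw [← hg₁g]; exact hgC.sub contDiff_const
  have hg₁supp' : tsupport g₁ ⊆ Icc (ε / 2) (2 * π - ε / 2) := by
    refine tsupport_mul_subset_left.trans (χ.tsupport_eq.le.trans ?_)
    intro x hx
    rw [hrOut, mem_closedBall, Real.dist_eq, abs_le] at hx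
    constructor <;> linarith [hx.1, hx.2]
  have hg₁supp : tsupport g₁ ⊆ Ioo 0 (2 * π) := tsupport_tilt_sub_one_subset hχ
  have hg₁cpt : HasCompactSupport g₁ := by
    refine HasCompactSupport.of_support_subset_isCompact (isCompact_closedBall (π : ℝ) χ.rOut) ?_
    refine (subset_tsupport _).trans ?_
    exact tsupport_mul_subset_left.trans χ.tsupport_eq.le
  obtain ⟨c, Cg, hc, hgc, hgb⟩ := exists_bounds_tilt (p := p) hχ
  have hg0 : ∀ x, g x ≠ 0 := fun x ↦ (hc.trans_le (hgc x)).ne'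
  have hgcont : Continuous g := hgC.continuous
  -- the potential `V = L_{ρ₁} g₁ / g`
  set V : ℝ → ℝ := fun x ↦ angleGenerator κ ρ₁ g₁ x / g x with hVdef
  have hLg₁ : Continuous (angleGenerator κ ρ₁ g₁) := continuous_angleGenerator hg₁C hg₁supp
  obtain ⟨CL, hCL0, hCL⟩ := exists_bound_angleGenerator (κ := κ) (ρ := ρ₁) hg₁C hg₁cpt hg₁supp
  have hVcont : Continuous V := hLg₁.div hgcont hg0
  have hVb : ∀ x, |V x| ≤ CL / c := fun x ↦ by
    simp only [hVdef]
    rw [abs_div, abs_of_pos (hc.trans_le (hgc x))]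
    exact div_le_div₀ hCL0 (hCL x) hc (hgc x)
  -- derivatives of `g` and `g₁` agree
  have hDg₁ : ∀ x, deriv g₁ x = deriv g x := fun x ↦ by
    rw [← hg₁g]; exact deriv_sub_const _
  have hD2g₁ : ∀ x, iteratedDeriv 2 g₁ x = iteratedDeriv 2 g x := fun x ↦ by
    have : g₁ = fun x ↦ (-1 : ℝ) + g x := by funext x; rw [← hg₁g]; ring
    rw [this, iteratedDeriv_const_add (by norm_num)]
  refine ⟨g, V, c, Cg, CL / c, hc, hgcont, hVcont, hgc, hgb, hVb, hg₁g ▸ hg₁C, hg₁g ▸ hg₁supp',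
    fun x ↦ ?_, fun F hF hFsupp ↦ ⟨hgC.mul hF, tsupport_mul_subset_right, fun x ↦ ?_⟩⟩
  · rw [hg₁g]
    simp only [hVdef]
    rw [div_mul_cancel₀ _ (hg0 x)]
  · -- the `h`-transform identity
    have hball : Ioo ε (2 * π - ε) = ball (π : ℝ) χ.rIn := by
      rw [hrIn, Real.ball_eq_Ioo]; ring_nf
    by_cases hx : x ∈ ball (π : ℝ) χ.rIn
    · -- inside: Leibniz, and `κ g' = ((ρ₂ - ρ₁)/2) cot g`
      have hg' : deriv g x = p / 2 * Real.cot (x / 2) * g x := (hasDerivAt_tilt hχ hx).deriv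
      have hDgF := deriv_fun_mul (hgC.differentiable (by norm_num) x) (hF.differentiable (by norm_num) x)
      have hD2gF := iteratedDeriv_two_mul_apply (x := x) hgC.contDiffAt hF.contDiffAt
      simp only [angleGenerator, hVdef, hDg₁, hD2g₁, hDgF, hD2gF]
      have hgx : g x ≠ 0 := hg0 x
      have hκD : (κ : ℝ) * deriv g x = (ρ₂ - ρ₁) / 2 * Real.cot (x / 2) * g x := by
        rw [hg']; linear_combination (Real.cot (x / 2) * g x) * hκp
      have hcancel : ∀ a : ℝ, a / g x * (g x * F x) = a * F x := fun a ↦ by field_simp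
      rw [hcancel]
      linear_combination (deriv F x) * hκD
    · -- outside: everything vanishes
      have hxF : x ∉ tsupport F := fun h ↦ hx (hball ▸ hFsupp h)
      have hxgF : x ∉ tsupport (fun x ↦ g x * F x) := fun h ↦ hxF (tsupport_mul_subset_right h)
      have hF0 : F x = 0 := by
        by_contra h
        exact hxF (subset_tsupport _ (Function.mem_support.2 h))
      rw [angleGenerator_eq_zero_of_notMem_tsupport hxgF, angleGenerator_eq_zero_of_notMem_tsupport hxF, hF0]
      ring

end TiltTarget

/-! ### The tilted measure on a general filtered probability space -/

section General

variable {Ω : Type*} {mΩ : MeasurableSpace Ω} {𝓕 : Filtration ℝ≥0 mΩ} {X : ℝ≥0 → Ω → ℝ}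

/-- A test function supported in `(a, b)` has compact support. [folklore] -/
theorem hasCompactSupport_of_tsupport_subset_Ioo {f : ℝ → ℝ} {a b : ℝ} (hf : tsupport f ⊆ Ioo a b) :
    HasCompactSupport f :=
  HasCompactSupport.of_support_subset_isCompact isCompact_Icc
    ((subset_tsupport f).trans (hf.trans Ioo_subset_Icc_self))

/-- A test function supported in `[a, b]` has compact support. [folklore] -/
theorem hasCompactSupport_of_tsupport_subset_Icc {f : ℝ → ℝ} {a b : ℝ} (hf : tsupport f ⊆ Icc a b) :
    HasCompactSupport f :=
  HasCompactSupport.of_support_subset_isCompact isCompact_Icc ((subset_tsupport f).trans hf)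

/-- A process which agrees on `[0, T]` with one whose set integrals against past events are
constant, and is frozen after `T`, is a martingale under a finite measure (packaging of the
set-integral form of the martingale property; general filtration). [folklore] -/
theorem martingale_min_of_setIntegral_eq' {Q : Measure Ω} [IsFiniteMeasure Q] {Y : ℝ≥0 → Ω → ℝ}
    (hYm : ∀ r : ℝ≥0, Measurable[𝓕 r] (Y r)) (hYb : ∀ r : ℝ≥0, ∃ C, ∀ ω, |Y r ω| ≤ C)
    {T : ℝ≥0}
    (h : ∀ s t : ℝ≥0, s ≤ t → t ≤ T → ∀ A, MeasurableSet[𝓕 s] A →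
      ∫ ω in A, Y t ω ∂Q = ∫ ω in A, Y s ω ∂Q) :
    Martingale (fun (t : ℝ≥0) ω ↦ Y (min t T) ω) 𝓕 Q := by
  have hint : ∀ r, Integrable (Y r) Q := fun r ↦ by
    obtain ⟨C, hC⟩ := hYb r
    exact Integrable.mono' (integrable_const C) (((hYm r).mono (𝓕.le r) le_rfl)).aestronglyMeasurable
      (Eventually.of_forall fun ω ↦ by rw [Real.norm_eq_abs]; exact hC ω)
  have hmeas : ∀ t, StronglyMeasurable[𝓕 t] (Y (min t T)) := fun t ↦
    ((hYm (min t T)).mono (𝓕.mono (min_le_left t T)) le_rfl).stronglyMeasurable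
  refine ⟨hmeas, fun s t hst ↦ ?_⟩
  symm
  refine ae_eq_condExp_of_forall_setIntegral_eq (𝓕.le s) (hint _)
    (fun A _ _ ↦ (hint _).integrableOn) (fun A hA _ ↦ ?_) (hmeas s).aestronglyMeasurable
  show ∫ ω in A, Y (min s T) ω ∂Q = ∫ ω in A, Y (min t T) ω ∂Q
  rcases le_total T s with hTs | hsT
  · rw [min_eq_right hTs, min_eq_right (hTs.trans hst)]
  · rw [min_eq_left hsT]
    exact (h s (min t T) (le_min hst hsT) (min_le_right t T) A hA).symm

/-- **Exponential change of measure for the SLE_κ(ρ) angle martingale problem, between two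
force-point parameters (general filtered space).** Let `X` be a continuous progressively measurable
real process on a filtered probability space `(Ω, 𝓕, P)` solving the `(κ, ρ₁)` angle martingale
problem in martingale form for all `C²` test functions supported in `[ε/2, 2π - ε/2]`
(`0 < ε < π`, `κ > 0`): `f(X_t) - f(X_0) - ∫₀ᵗ (L_{ρ₁} f)(X_s) ds` is an `𝓕`-martingale. For every
`ρ₂ ∈ ℝ` and horizon `T` there is a probability measure `Q`, mutually absolutely continuous with
`P` (it is `N_T · P` for the exponential density of the localised tilt function
`g ≈ sin(·/2)^{(ρ₂-ρ₁)/κ}` of `exists_angleTilt_target`), under which **the `(κ, ρ₂)` angle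
martingale problem holds up to time `T` for every `C²` test function supported in `(ε, 2π - ε)`**:
`t ↦ f(X_{t∧T}) - f(X_0) - ∫₀^{t∧T} (L_{ρ₂} f)(X_s) ds` is an `𝓕`-martingale under `Q`
(Miller–Sheffield (2013), §2.1.2 after (2.5), local absolute continuity of the SLE_κ(ρ) angle
processes in `ρ`; Schramm–Wilson (2005) for `ρ₂ - ρ₁ = κ - 6`; proof by the exponential change of
measure of Palmowski–Rolski (2002), Thm 4.2). [cite: MillerSheffield2013, §2.1.2] -/
theorem exists_tilted_measure_target {P : Measure Ω} [IsProbabilityMeasure P] {κ : ℝ≥0} (ρ₁ ρ₂ : ℝ)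
    (hκ : 0 < κ) (hX : IsStronglyProgressive 𝓕 X) (hXc : ∀ ω, Continuous (X · ω))
    {ε : ℝ} (hε : 0 < ε) (hεπ : ε < π)
    (hMP : ∀ f : ℝ → ℝ, ContDiff ℝ 2 f → tsupport f ⊆ Icc (ε / 2) (2 * π - ε / 2) →
      Martingale (fun (t : ℝ≥0) ω ↦ f (X t ω) - f (X 0 ω) -
        timeIntegral (fun s ω ↦ angleGenerator κ ρ₁ f (X s ω)) t ω) 𝓕 P)
    (T : ℝ≥0) :
    ∃ Q : Measure Ω, IsProbabilityMeasure Q ∧ P ≪ Q ∧ Q ≪ P ∧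
      ∀ f : ℝ → ℝ, ContDiff ℝ 2 f → tsupport f ⊆ Ioo ε (2 * π - ε) →
        Martingale (fun (t : ℝ≥0) ω ↦ f (X (min t T) ω) - f (X 0 ω) -
          timeIntegral (fun s ω ↦ angleGenerator κ ρ₂ f (X s ω)) (min t T) ω) 𝓕 Q := by
  obtain ⟨g, V, c, Cg, CV, hc, hg, hV, hgc, hgb, hVb, hg1C, hg1supp, hVg, hF⟩ :=
    exists_angleTilt_target κ ρ₁ ρ₂ hκ hε hεπ
  have hIoo : Ioo ε (2 * π - ε) ⊆ Ioo 0 (2 * π) := Ioo_subset_Ioo hε.le (by linarith)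
  -- the martingale for `g`
  have hMg : Martingale (fun (t : ℝ≥0) ω ↦ g (X t ω) - g (X 0 ω) -
      timeIntegral (fun s ω ↦ V (X s ω) * g (X s ω)) t ω) 𝓕 P := by
    have h := hMP _ hg1C hg1supp
    have heq : (fun (t : ℝ≥0) ω ↦ (g (X t ω) - 1) - (g (X 0 ω) - 1) -
        timeIntegral (fun s ω ↦ angleGenerator κ ρ₁ (fun y ↦ g y - 1) (X s ω)) t ω) =
        fun (t : ℝ≥0) ω ↦ g (X t ω) - g (X 0 ω) -
          timeIntegral (fun s ω ↦ V (X s ω) * g (X s ω)) t ω := by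
      funext t ω
      simp only [hVg]
      ring
    rwa [heq] at h
  -- the tilted measure
  set d : Ω → ℝ := fun ω ↦ g (X T ω) / g (X 0 ω) *
    Real.exp (-timeIntegral (fun s ω ↦ V (X s ω)) T ω) with hddef
  refine ⟨P.withDensity fun ω ↦ ENNReal.ofReal (d ω),
    isProbabilityMeasure_withDensity_expDensity hX hXc hg hV hc hgc hgb hVb hMg T,
    absolutelyContinuous_withDensity_expDensity hX hXc hg hV hc hgc hgb hVb hMg T,
    withDensity_absolutelyContinuous _ _, fun f hfC hfsupp ↦ ?_⟩
  haveI := isProbabilityMeasure_withDensity_expDensity hX hXc hg hV hc hgc hgb hVb hMg T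
  have hfsupp' : tsupport f ⊆ Ioo 0 (2 * π) := hfsupp.trans hIoo
  have hfcpt : HasCompactSupport f := hasCompactSupport_of_tsupport_subset_Ioo hfsupp
  obtain ⟨hgfC, hgfsupp, hrel⟩ := hF f hfC hfsupp
  have hgfsupp' : tsupport (fun x ↦ g x * f x) ⊆ Ioo 0 (2 * π) := hgfsupp.trans hfsupp'
  have hgfsuppI : tsupport (fun x ↦ g x * f x) ⊆ Icc (ε / 2) (2 * π - ε / 2) :=
    hgfsupp.trans (hfsupp.trans fun x hx ↦ ⟨by linarith [hx.1], by linarith [hx.2]⟩)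
  have hgfcpt : HasCompactSupport (fun x ↦ g x * f x) := hfcpt.mul_left
  -- the data `ψ₂ = L_{ρ₁} (g f)`, `ψ' = L_{ρ₂} f`
  have hψ₂c : Continuous (angleGenerator κ ρ₁ (fun x ↦ g x * f x)) := continuous_angleGenerator hgfC hgfsupp'
  have hψ'c : Continuous (angleGenerator κ ρ₂ f) := continuous_angleGenerator hfC hfsupp'
  obtain ⟨Cψ₂, -, hψ₂b⟩ := exists_bound_angleGenerator (κ := κ) (ρ := ρ₁) hgfC hgfcpt hgfsupp'
  obtain ⟨Cψ', -, hψ'b⟩ := exists_bound_angleGenerator (κ := κ) (ρ := ρ₂) hfC hfcpt hfsupp'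
  obtain ⟨Cf, -, hfb⟩ := exists_bound_of_hasCompactSupport hfC.continuous hfcpt
  -- the martingale for `g f`
  have hMgf : Martingale (fun (t : ℝ≥0) ω ↦ g (X t ω) * f (X t ω) - g (X 0 ω) * f (X 0 ω) -
      timeIntegral (fun s ω ↦ angleGenerator κ ρ₁ (fun y ↦ g y * f y) (X s ω)) t ω) 𝓕 P :=
    hMP _ hgfC hgfsuppI
  -- the set-integral identity under `Q` for `Φ_r = f(X_r) - ∫₀ʳ L_{ρ₂} f(X)`
  have key : ∀ s t : ℝ≥0, s ≤ t → t ≤ T → ∀ A, MeasurableSet[𝓕 s] A →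
      ∫ ω in A, (f (X t ω) - timeIntegral (fun s ω ↦ angleGenerator κ ρ₂ f (X s ω)) t ω)
          ∂(P.withDensity fun ω ↦ ENNReal.ofReal (d ω)) =
        ∫ ω in A, (f (X s ω) - timeIntegral (fun s ω ↦ angleGenerator κ ρ₂ f (X s ω)) s ω)
          ∂(P.withDensity fun ω ↦ ENNReal.ofReal (d ω)) := fun s t hst htT A hA ↦
    setIntegral_withDensity_expDensity_eq hX hXc hg hV hfC.continuous hψ₂c hψ'c hc hgc hgb hVb hfb
      hψ₂b hψ'b hMg hMgf hrel hst htT hA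
  -- package as a martingale for `Φ_{· ∧ T} - f(X_0)`
  have hΦm : ∀ r : ℝ≥0, Measurable[𝓕 r]
      fun ω ↦ f (X r ω) - timeIntegral (fun s ω ↦ angleGenerator κ ρ₂ f (X s ω)) r ω :=
    fun r ↦ ((hfC.continuous.comp_stronglyMeasurable (hX.stronglyAdapted r)).measurable).sub
      (adapted_timeIntegral (IsStronglyProgressive.continuous_comp hX hψ'c) r)
  have hf0m : ∀ r : ℝ≥0, Measurable[𝓕 r] fun ω ↦ f (X 0 ω) := fun r ↦
    (hfC.continuous.comp_stronglyMeasurable ((hX.stronglyAdapted 0).mono (𝓕.mono bot_le))).measurable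
  have hYeq : ∀ r : ℝ≥0, (fun ω ↦ f (X r ω) - f (X 0 ω) -
      timeIntegral (fun s ω ↦ angleGenerator κ ρ₂ f (X s ω)) r ω) = fun ω ↦
      (f (X r ω) - timeIntegral (fun s ω ↦ angleGenerator κ ρ₂ f (X s ω)) r ω) - f (X 0 ω) :=
    fun r ↦ by funext ω; ring
  refine martingale_min_of_setIntegral_eq' (𝓕 := 𝓕)
    (Q := P.withDensity fun ω ↦ ENNReal.ofReal (d ω))
    (Y := fun r ω ↦ f (X r ω) - f (X 0 ω) - timeIntegral (fun s ω ↦ angleGenerator κ ρ₂ f (X s ω)) r ω)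
    (T := T) (fun r ↦ by rw [hYeq r]; exact (hΦm r).sub (hf0m r)) (fun r ↦ ?_) fun s t hst htT A hA ↦ ?_
  · refine ⟨Cf + Cf + Cψ' * r, fun ω ↦ ?_⟩
    have h1 := hfb (X r ω)
    have h2 := hfb (X 0 ω)
    have h3 := abs_timeIntegral_le (g := fun s ω ↦ angleGenerator κ ρ₂ f (X s ω)) (fun s ω ↦ hψ'b _) r ω
    calc |f (X r ω) - f (X 0 ω) - timeIntegral (fun s ω ↦ angleGenerator κ ρ₂ f (X s ω)) r ω|
        ≤ |f (X r ω) - f (X 0 ω)| + |timeIntegral (fun s ω ↦ angleGenerator κ ρ₂ f (X s ω)) r ω| :=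
          abs_sub _ _
      _ ≤ (|f (X r ω)| + |f (X 0 ω)|) + Cψ' * r := add_le_add (abs_sub _ _) h3
      _ ≤ Cf + Cf + Cψ' * r := by linarith
  · have hf0i : Integrable (fun ω ↦ f (X 0 ω)) (P.withDensity fun ω ↦ ENNReal.ofReal (d ω)) :=
      Integrable.mono' (integrable_const Cf)
        (((hf0m 0).mono (𝓕.le 0) le_rfl)).aestronglyMeasurable
        (Eventually.of_forall fun ω ↦ by rw [Real.norm_eq_abs]; exact hfb _)
    have hΦi : ∀ r : ℝ≥0, Integrable
        (fun ω ↦ f (X r ω) - timeIntegral (fun s ω ↦ angleGenerator κ ρ₂ f (X s ω)) r ω)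
        (P.withDensity fun ω ↦ ENNReal.ofReal (d ω)) := fun r ↦
      Integrable.mono' (integrable_const (Cf + Cψ' * r))
        (((hΦm r).mono (𝓕.le r) le_rfl)).aestronglyMeasurable
        (Eventually.of_forall fun ω ↦ by
          rw [Real.norm_eq_abs]
          exact (abs_sub _ _).trans (add_le_add (hfb _)
            (abs_timeIntegral_le (fun s ω ↦ hψ'b _) r ω)))
    simp only [hYeq]
    rw [integral_sub (hΦi t).integrableOn hf0i.integrableOn,
      integral_sub (hΦi s).integrableOn hf0i.integrableOn, key s t hst htT A hA]

end General

/-! ### The canonical two-sided path space: the coordinate process -/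

section Canonical

variable {κ : ℝ≥0} {ρ : ℝ} {P : Measure C(ℝ, ℝ)}

/-- The time integral of a function of the coordinate process is the interval integral along the
path. [folklore] -/
theorem timeIntegral_coordProc (G : ℝ → ℝ) (t : ℝ≥0) (x : C(ℝ, ℝ)) :
    timeIntegral (fun s x ↦ G (coordProc s x)) t x = ∫ u in (0 : ℝ)..t, G (x u) := by
  rw [timeIntegral_apply_eq_intervalIntegral]
  refine intervalIntegral.integral_congr fun u hu ↦ ?_
  rw [uIcc_of_le t.coe_nonneg] at hu
  simp only [coordProc_apply, Real.coe_toNNReal _ hu.1]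

/-- **The martingale-problem increment from time `0` in process form**:
`angleIncrement κ ρ f 0 t = f(X_t) - f(X_0) - ∫₀ᵗ (L_ρ f)(X_s) ds`. [folklore] -/
theorem angleIncrement_zero_eq (κ : ℝ≥0) (ρ : ℝ) (f : ℝ → ℝ) (t : ℝ≥0) (x : C(ℝ, ℝ)) :
    angleIncrement κ ρ f 0 t x = f (coordProc t x) - f (coordProc 0 x) -
      timeIntegral (fun s x ↦ angleGenerator κ ρ f (coordProc s x)) t x := by
  rw [timeIntegral_coordProc, angleIncrement]
  simp

/-- **A stationary angle law solves the martingale problem in martingale form on `[0, ∞)`**: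
`t ↦ angleIncrement κ ρ f 0 t` is a `pastFiltration`-martingale for every `C²` test function `f`
compactly supported in `(0, 2π)` (increment additivity and the conditional-expectation clause of
`IsStationaryAngleLaw`). [cite: MillerSheffield2013, Prop. 2.1] -/
theorem IsStationaryAngleLaw.martingale_angleIncrement (h : IsStationaryAngleLaw κ ρ P) {f : ℝ → ℝ}
    (hf : ContDiff ℝ 2 f) (hc : HasCompactSupport f) (hsupp : tsupport f ⊆ Ioo 0 (2 * π)) :
    Martingale (fun (t : ℝ≥0) x ↦ angleIncrement κ ρ f 0 t x) pastFiltration P := by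
  haveI := h.isProbabilityMeasure
  refine ⟨fun t ↦ (measurable_angleIncrement_angleFiltration hf hsupp t.coe_nonneg).stronglyMeasurable,
    fun s t hst ↦ ?_⟩
  have hst' : (s : ℝ) ≤ t := NNReal.coe_le_coe.2 hst
  obtain ⟨hint, hce⟩ := h.2.2.2 f hf hc hsupp s t hst'
  have hadd : (fun x ↦ angleIncrement κ ρ f 0 t x) =
      fun x ↦ angleIncrement κ ρ f 0 s x + angleIncrement κ ρ f s t x := by
    funext x
    have := angleIncrement_sub_angleIncrement (κ := κ) (ρ := ρ) hf hsupp 0 s t x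
    linarith
  have hs_meas : StronglyMeasurable[pastFiltration s] fun x ↦ angleIncrement κ ρ f 0 s x :=
    (measurable_angleIncrement_angleFiltration hf hsupp s.coe_nonneg).stronglyMeasurable
  have hs_int : Integrable (fun x ↦ angleIncrement κ ρ f 0 s x) P :=
    integrable_angleIncrement hf hc hsupp 0 s P
  show P[fun x ↦ angleIncrement κ ρ f 0 t x | pastFiltration s] =ᵐ[P] fun x ↦ angleIncrement κ ρ f 0 s x
  rw [hadd]
  calc P[fun x ↦ angleIncrement κ ρ f 0 s x + angleIncrement κ ρ f s t x | pastFiltration s]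
      =ᵐ[P] P[fun x ↦ angleIncrement κ ρ f 0 s x | pastFiltration s] +
          P[angleIncrement κ ρ f s t | pastFiltration s] := condExp_add hs_int hint _
    _ =ᵐ[P] (fun x ↦ angleIncrement κ ρ f 0 s x) + 0 := by
        refine Filter.EventuallyEq.add ?_ hce
        exact Eventually.of_forall fun x ↦ congrFun
          (condExp_of_stronglyMeasurable (pastFiltration.le s) hs_meas hs_int) x
    _ = fun x ↦ angleIncrement κ ρ f 0 s x := by simp

/-- A process on path space which agrees on `[0, T]` with one whose set integrals against past
events are constant, and is frozen after `T`, is a martingale under a finite measure (the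
coordinate-space instance of `martingale_min_of_setIntegral_eq'`). [folklore] -/
theorem martingale_min_of_setIntegral_eq {Q : Measure C(ℝ, ℝ)} [IsFiniteMeasure Q] {Y : ℝ≥0 → C(ℝ, ℝ) → ℝ}
    (hYm : ∀ r : ℝ≥0, Measurable[pastFiltration r] (Y r)) (hYb : ∀ r : ℝ≥0, ∃ C, ∀ x, |Y r x| ≤ C)
    {T : ℝ≥0}
    (h : ∀ s t : ℝ≥0, s ≤ t → t ≤ T → ∀ A, MeasurableSet[pastFiltration s] A →
      ∫ x in A, Y t x ∂Q = ∫ x in A, Y s x ∂Q) :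
    Martingale (fun (t : ℝ≥0) x ↦ Y (min t T) x) pastFiltration Q :=
  martingale_min_of_setIntegral_eq' hYm hYb h

/-- **Exponential change of measure for the SLE_κ(ρ) angle martingale problem** (canonical form).
Let `P` be a probability measure on `C(ℝ, ℝ)` solving the `(κ, ρ)` angle martingale problem in
martingale form on `[0, ∞)` (e.g. a stationary angle law,
`IsStationaryAngleLaw.martingale_angleIncrement`), `κ > 0`. For `0 < ε < π` and a horizon `T` there
is a probability measure `Q`, mutually absolutely continuous with `P` (it is `N_T · P` for the
exponential density of the localised tilt function `g ≈ sin(·/2)^{-ρ/κ}`), under which **the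
`(κ, 0)` angle martingale problem holds up to time `T` for every `C²` test function supported in
`(ε, 2π - ε)`**: `t ↦ angleIncrement κ 0 f 0 (t ∧ T)` is a `pastFiltration`-martingale under `Q`
(Miller–Sheffield (2013), §2.1.2 after (2.5): the law of the SLE_κ(ρ) angle / driving process is
locally absolutely continuous with respect to the `ρ = 0` one; here by the exponential change of
measure of Palmowski–Rolski (2002), Thm 4.2, instead of the Girsanov theorem).
[cite: MillerSheffield2013, §2.1.2] -/
theorem exists_tilted_measure [IsProbabilityMeasure P] (hκ : 0 < κ)
    (hMP : ∀ f : ℝ → ℝ, ContDiff ℝ 2 f → HasCompactSupport f → tsupport f ⊆ Ioo 0 (2 * π) →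
      Martingale (fun (t : ℝ≥0) x ↦ angleIncrement κ ρ f 0 t x) pastFiltration P)
    {ε : ℝ} (hε : 0 < ε) (hεπ : ε < π) (T : ℝ≥0) :
    ∃ Q : Measure C(ℝ, ℝ), IsProbabilityMeasure Q ∧ P ≪ Q ∧ Q ≪ P ∧
      ∀ f : ℝ → ℝ, ContDiff ℝ 2 f → tsupport f ⊆ Ioo ε (2 * π - ε) →
        Martingale (fun (t : ℝ≥0) x ↦ angleIncrement κ 0 f 0 (min t T) x) pastFiltration Q := by
  have hIcc : Icc (ε / 2) (2 * π - ε / 2) ⊆ Ioo 0 (2 * π) := fun x hx ↦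
    ⟨by linarith [hx.1], by linarith [hx.2]⟩
  have hMP' : ∀ f : ℝ → ℝ, ContDiff ℝ 2 f → tsupport f ⊆ Icc (ε / 2) (2 * π - ε / 2) →
      Martingale (fun (t : ℝ≥0) x ↦ f (coordProc t x) - f (coordProc 0 x) -
        timeIntegral (fun s x ↦ angleGenerator κ ρ f (coordProc s x)) t x) pastFiltration P := by
    intro f hf hsupp
    have h := hMP f hf (hasCompactSupport_of_tsupport_subset_Icc hsupp) (hsupp.trans hIcc)
    have heq : (fun (t : ℝ≥0) x ↦ angleIncrement κ ρ f 0 t x) = fun (t : ℝ≥0) x ↦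
        f (coordProc t x) - f (coordProc 0 x) -
          timeIntegral (fun s x ↦ angleGenerator κ ρ f (coordProc s x)) t x := by
      funext t x; rw [angleIncrement_zero_eq]
    rwa [heq] at h
  obtain ⟨Q, hQ, hPQ, hQP, hmart⟩ := exists_tilted_measure_target (𝓕 := pastFiltration) ρ 0 hκ
    isStronglyProgressive_coordProc continuous_coordProc hε hεπ hMP' T
  refine ⟨Q, hQ, hPQ, hQP, fun f hf hsupp ↦ ?_⟩
  have h := hmart f hf hsupp
  have heq : (fun (t : ℝ≥0) x ↦ angleIncrement κ 0 f 0 (min t T) x) = fun (t : ℝ≥0) x ↦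
      f (coordProc (min t T) x) - f (coordProc 0 x) -
        timeIntegral (fun s x ↦ angleGenerator κ 0 f (coordProc s x)) (min t T) x := by
    funext t x; rw [← NNReal.coe_min, angleIncrement_zero_eq]
  rwa [heq]

end Canonical

end Literature.Probability.RandomPlanarGeometry
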